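import Summits.QuantumFields.YangMills.Theorems.BalabanUVNodesN11CondExpOfWeakIdentity

/-!
# DAG node N11 — THE FUBINI REDUCTION OF (hweak): the weak identity of the skew conditional expectation follows from the FROZEN-`y` FIBREWISE IDENTITY —
# «for a.e. retained fine configuration `y` and every bounded measurable `h` of the NEW coarse variables alone, ∫ piece(e⁻¹(y,u))·h(φ(y,u)) du = ∫ R̃(y,v)·h(v) dv»

HEADER — WORK-UNIT METADATA.  Cell `pub-ymgap`, YM-PLAN Track A (D-0062), seat `pub-ymgap-dag-n11-d` (g17; N11 [B14], s2), route `BalabanUVNodes`, item K1⁹ = stmt-QuantumFields-27364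
(helper lane, `--kind proof --supports 27364 --as helper`, count-neutral).  [I] = [Balaban1987RG1], [III] = [Balaban1988Convergent].  Sequel of this seat's p646357
`…N11CondExpOfWeakIdentity` (the WEAK FORM (hweak) of the conditional-expectation identity (hce₀) of the (O3′) clause) over def-T's `Literature/…/T4AveragingDisintegration`
(`kernelTransport`) and dag-n11-e's `Node00/AveragingSkewPresentation` (`measurable_avOfRecord_glue_rest`, `measurePreserving_piEquivPiSubtypeProd_symm_fieldMeasure`).

WHY THIS FILE.  p646357 left, per old branch `S₀`, ONE displayed identity
  (hweak)  ∀ f bounded measurable on the presented point z = (y, v₂):  ∫ (piece_{S₀} ∘ e⁻¹)(q) · f(q.1, φ q) dμ_in(q) = ∫ R̃_{S₀}(z) · f(z) dμ_out(z),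
`μ_in = (⊗_{b ∈ B_k(Ω^c_{k+1})} dU(b)) ⊗ (⊗_{b ∉ …} dU(b))`, `μ_out = (⊗_{b ∈ B_k(Ω^c_{k+1})} dU(b)) ⊗ (⊗_{c ∉ B_{k+1}(Ω^c_{k+1})} dV(c))`, `φ q = (c ↦ Ū(e⁻¹ q)(c))` the averages on the
new coarse bonds.  Both reference measures are PRODUCTS with the same first factor and the skew map keeps the first coordinate, so by Fubini on both sides (hweak) follows from the
FROZEN-`y` FIBREWISE IDENTITY
  (hfib)   for (⊗ dU(b))-a.e. y and every bounded measurable h of the new variables v ALONE:  ∫ piece_{S₀}(e⁻¹(y,u)) · h(φ(y,u)) du = ∫ R̃_{S₀}(y,v) · h(v) dv,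
which is the SHAPE OF PRINT'S COMPUTATION ([III] (3.10)–(3.25) p.267–270 at the first step [I] §2 p.267): the retained variables `U|_{Ω^c_{k+1}}` are FROZEN, the variables over
`Ω_{k+1}` are integrated against `∏_c δ(V(c)Ū(c)⁻¹)` — one identity between a `du`-integral and a `dv`-integral, `y` a parameter, no joint test function.  The `μ_out`-integrability of
the candidate `R̃_{S₀}` that Fubini needs on the right is NOT displayed: for a nonnegative measurable candidate it FOLLOWS from (hfib) (test with `𝟙{R̃(y,·) ≤ n}`, monotone
convergence on each fibre, Tonelli) — at the record `R̃_{S₀} ≥ 0` and measurable are theorems (p646357 §2–§3).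

WHAT THIS FILE PROVES (0 `def`, 0 `sorry`, standard axioms).  §1 (generic measurable spaces, any finite measures): ★ `integrable_candidate_of_fibrewise` (integrability of a
nonnegative measurable candidate from (hfib)) · ★★ `weak_of_fibrewise` (the Fubini reduction, candidate integrable) · ★★ `weak_of_fibrewise_of_nonneg`.  §2 (record letters, ANY
`dU`-integrable `ρ`, ANY candidate `R`): ★★ `weak_of_fibrewise_at_record` (p646357's (hweak) VERBATIM from (hfib)) · ★★★ `condExp_identity_of_fibrewise_of_nonneg` ((hce₀) from (hfib)) ·
`integral_comp_glue_symm_eq` (the `dU`-form of the left member: `∫ (ρ ∘ e⁻¹)·F dμ_in = ∫ ρ·(F ∘ e) dU`).  The Stage-13 ∕ first-step editions of the (O3′) clause are the sequel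
`…N11O3OfFibrewiseIdentityAtRecord13`.

HONEST FRAMING.  Helper lane of K1⁹; count-neutral; [folklore] measure theory (Fubini ∕ Tonelli, monotone convergence, measure-preserving re-coordinatisation) over def-T's DEFINITIONS;
(hfib) DISPLAYED — it IS [I] §2 + gauge fixing + `ζ` + [III] Thm 2 ([I] Thm 1 + [II] at the first step), NOT proved; nothing of Bałaban asserted; N11 NOT discharged; K1⁹ NOT closed, no
registered stub touched; counts unmoved (typed 28∕28 · discharged 5∕27 · A 5∕28).  One finite `𝕋⁴_{L^K}` programme at fixed `ε = L^{−K}` — NOT ℝ⁴, NOT OS, NOT a mass gap, NOT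
Clay.  No `sorry`, `axiom`, `def`, `instance`, `notation`.  Sources (SHAPE only): [III] (2.18) p.257, (2.20)–(2.21) p.258, (3.1) p.264, (3.10)–(3.14) p.267, (3.23)–(3.25) p.270;
[I] (0.4) p.253, §2 p.267.
-/

noncomputable section

open MeasureTheory ProbabilityTheory
open scoped ENNReal NNReal BigOperators

namespace Summit.QuantumFields.YangMills.Theorems.BalabanUVNodesN11CondExpOfFibrewiseIdentity

open Literature.MathematicalPhysics.QuantumFieldTheory.Balaban1983to89
open Literature.MathematicalPhysics.QuantumFieldTheory.Balaban1983to89.T4AveragingDisintegration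
open BalabanUVNodesN11CondExpOfWeakIdentity (condExp_identity_of_weak_of_nonneg condExp_identity_of_weak)
open Node00 hiding SU
open Node00.Tk T4Continuum
open B10Eq42TorusConstraint (bondsIn)

/-! ## §1  Generic: Fubini reduction of a weak identity along a first-coordinate-preserving map -/

section Generic

variable {Y U V : Type*} [MeasurableSpace Y] [MeasurableSpace U] [MeasurableSpace V]

/-- ★ **INTEGRABILITY OF A NONNEGATIVE MEASURABLE CANDIDATE FROM THE FIBREWISE IDENTITY**: if `ρ` is `μy ⊗ ν`-integrable, `R ≥ 0` is measurable and for `μy`-a.e. `y` the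
fibrewise identity `∫ ρ(y,u)·h(φ(y,u)) dν = ∫ R(y,v)·h(v) dμ₂` holds for every bounded measurable `h`, then `R` is `μy ⊗ μ₂`-integrable (test with `𝟙{R(y,·) ≤ n}`: the truncated
fibre integrals are bounded by `∫ |ρ(y,·)| dν`; monotone convergence on each fibre; the fibre masses are `∫ ρ(y,·) dν`, integrable in `y`). [folklore] -/
theorem integrable_candidate_of_fibrewise (μy : Measure Y) [SFinite μy] (ν : Measure U) [SFinite ν] (μ₂ : Measure V) [IsFiniteMeasure μ₂]
    {ρ : Y × U → ℝ} (hρ : Integrable ρ (μy.prod ν)) {φ : Y × U → V} (hφ : Measurable φ)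
    {R : Y × V → ℝ} (hR0 : ∀ z, 0 ≤ R z) (hRm : Measurable R)
    (hfib : ∀ᵐ y ∂μy, ∀ h : V → ℝ, Measurable h → (∃ C : ℝ, ∀ v, |h v| ≤ C) →
      ∫ u, ρ (y, u) * h (φ (y, u)) ∂ν = ∫ v, R (y, v) * h v ∂μ₂) :
    Integrable R (μy.prod μ₂) := by
  rw [integrable_prod_iff hRm.aestronglyMeasurable]
  have hsec : ∀ᵐ y ∂μy, Integrable (fun v => R (y, v)) μ₂ := by
    filter_upwards [hfib, hρ.prod_right_ae] with y hy hρy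
    have hRy : Measurable fun v => R (y, v) := hRm.comp measurable_prodMk_left
    refine ⟨hRy.aestronglyMeasurable, ?_⟩
    -- the truncated fibre integrals are bounded by `∫ |ρ(y,·)| dν`
    have hS : ∀ n : ℕ, MeasurableSet {v : V | R (y, v) ≤ (n : ℝ)} := fun n => hRy measurableSet_Iic
    have hbd : ∀ n : ℕ, ∫ v, {v : V | R (y, v) ≤ (n : ℝ)}.indicator (fun v => R (y, v)) v ∂μ₂ ≤ ∫ u, |ρ (y, u)| ∂ν := by
      intro n
      have hind : Measurable ({v : V | R (y, v) ≤ (n : ℝ)}.indicator fun _ => (1 : ℝ)) := measurable_const.indicator (hS n)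
      have hind_bdd : ∀ v, |{v : V | R (y, v) ≤ (n : ℝ)}.indicator (fun _ => (1 : ℝ)) v| ≤ 1 := fun v => by
        by_cases hv : v ∈ {v : V | R (y, v) ≤ (n : ℝ)} <;> simp [hv]
      have h1 := hy _ hind ⟨1, hind_bdd⟩
      have h2 : (fun v => R (y, v) * {v : V | R (y, v) ≤ (n : ℝ)}.indicator (fun _ => (1 : ℝ)) v) =
          {v : V | R (y, v) ≤ (n : ℝ)}.indicator (fun v => R (y, v)) := by
        funext v
        by_cases hv : v ∈ {v : V | R (y, v) ≤ (n : ℝ)}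
        · rw [Set.indicator_of_mem hv, Set.indicator_of_mem hv, mul_one]
        · rw [Set.indicator_of_notMem hv, Set.indicator_of_notMem hv, mul_zero]
      rw [← h2, ← h1]
      have hI : Integrable (fun u => ρ (y, u) * {v : V | R (y, v) ≤ (n : ℝ)}.indicator (fun _ => (1 : ℝ)) (φ (y, u))) ν :=
        hρy.mul_bdd (hind.comp (hφ.comp measurable_prodMk_left)).aestronglyMeasurable
          (Filter.Eventually.of_forall fun u => by simpa [Real.norm_eq_abs] using hind_bdd (φ (y, u)))
      refine integral_mono hI hρy.abs fun u => ?_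
      by_cases hu : φ (y, u) ∈ {v : V | R (y, v) ≤ (n : ℝ)}
      · simp only [Set.indicator_of_mem hu, mul_one]; exact le_abs_self _
      · simp only [Set.indicator_of_notMem hu, mul_zero]; exact abs_nonneg _
    -- monotone convergence on the fibre
    have hmeas : ∀ n : ℕ, Measurable fun v => ENNReal.ofReal ({v : V | R (y, v) ≤ (n : ℝ)}.indicator (fun v => R (y, v)) v) :=
      fun n => (hRy.indicator (hS n)).ennreal_ofReal
    have hmono : Monotone fun (n : ℕ) (v : V) => ENNReal.ofReal ({v : V | R (y, v) ≤ (n : ℝ)}.indicator (fun v => R (y, v)) v) := by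
      intro n m hnm v
      refine ENNReal.ofReal_le_ofReal (Set.indicator_le_indicator_of_subset (fun v (hv : R (y, v) ≤ (n : ℝ)) => ?_) (fun _ => hR0 _) v)
      exact hv.trans (by exact_mod_cast hnm)
    have hsup : ∀ v, (⨆ n : ℕ, ENNReal.ofReal ({v : V | R (y, v) ≤ (n : ℝ)}.indicator (fun v => R (y, v)) v)) = ‖R (y, v)‖ₑ := by
      intro v
      rw [Real.enorm_eq_ofReal (hR0 _)]
      refine le_antisymm (iSup_le fun n => ENNReal.ofReal_le_ofReal (Set.indicator_le_self' (fun _ _ => hR0 _) v)) ?_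
      obtain ⟨n, hn⟩ := exists_nat_ge (R (y, v))
      refine le_iSup_of_le n (le_of_eq ?_)
      rw [Set.indicator_of_mem (show v ∈ {v : V | R (y, v) ≤ (n : ℝ)} from hn)]
    have hlin : ∫⁻ v, ‖R (y, v)‖ₑ ∂μ₂ = ⨆ n : ℕ, ∫⁻ v, ENNReal.ofReal ({v : V | R (y, v) ≤ (n : ℝ)}.indicator (fun v => R (y, v)) v) ∂μ₂ := by
      rw [← lintegral_iSup hmeas hmono]
      exact lintegral_congr fun v => (hsup v).symm
    show ∫⁻ v, ‖R (y, v)‖ₑ ∂μ₂ < ∞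
    rw [hlin]
    refine lt_of_le_of_lt (iSup_le fun n => ?_) (ENNReal.ofReal_lt_top (r := ∫ u, |ρ (y, u)| ∂ν))
    have hIn : Integrable ({v : V | R (y, v) ≤ (n : ℝ)}.indicator fun v => R (y, v)) μ₂ := by
      refine Integrable.of_bound (C := (n : ℝ)) (hRy.indicator (hS n)).aestronglyMeasurable (Filter.Eventually.of_forall fun v => ?_)
      by_cases hv : v ∈ {v : V | R (y, v) ≤ (n : ℝ)}
      · have hv' : R (y, v) ≤ n := hv
        rw [Set.indicator_of_mem hv, Real.norm_eq_abs, abs_of_nonneg (hR0 _)]; exact hv'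
      · rw [Set.indicator_of_notMem hv, norm_zero]; exact Nat.cast_nonneg n
    rw [← ofReal_integral_eq_lintegral_ofReal hIn (Filter.Eventually.of_forall fun v => Set.indicator_nonneg (fun _ _ => hR0 _) v)]
    exact ENNReal.ofReal_le_ofReal (hbd n)
  refine ⟨hsec, ?_⟩
  -- the fibre masses: `∫ ‖R(y,·)‖ dμ₂ = ∫ R(y,·) dμ₂ = ∫ ρ(y,·) dν`, integrable in `y`
  refine (hρ.integral_prod_left).congr ?_
  filter_upwards [hfib] with y hy
  have h1 := hy (fun _ => (1 : ℝ)) measurable_const ⟨1, fun _ => by simp⟩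
  simp only [mul_one] at h1
  rw [h1]
  exact integral_congr_ae (ae_of_all _ fun v => (by rw [Real.norm_eq_abs, abs_of_nonneg (hR0 _)] : R (y, v) = ‖R (y, v)‖))

/-- ★★ **THE FUBINI REDUCTION**: for `ρ` integrable w.r.t. `μy ⊗ ν`, `φ` measurable, `R` integrable w.r.t. `μy ⊗ μ₂`, the frozen-`y` fibrewise identity for `μy`-a.e. `y`
(every bounded measurable `h` of `v` alone) implies the weak identity for every bounded measurable `f` of `(y, v)`:
`∫ ρ(q)·f(q.1, φ q) d(μy ⊗ ν) = ∫ R(z)·f(z) d(μy ⊗ μ₂)` (Fubini on both sides; on the fibre over `y` test with `h := f(y,·)`). [folklore] -/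
theorem weak_of_fibrewise (μy : Measure Y) [SFinite μy] (ν : Measure U) [SFinite ν] (μ₂ : Measure V) [SFinite μ₂]
    {ρ : Y × U → ℝ} (hρ : Integrable ρ (μy.prod ν)) {φ : Y × U → V} (hφ : Measurable φ)
    {R : Y × V → ℝ} (hRint : Integrable R (μy.prod μ₂))
    (hfib : ∀ᵐ y ∂μy, ∀ h : V → ℝ, Measurable h → (∃ C : ℝ, ∀ v, |h v| ≤ C) →
      ∫ u, ρ (y, u) * h (φ (y, u)) ∂ν = ∫ v, R (y, v) * h v ∂μ₂)
    (f : Y × V → ℝ) (hf : Measurable f) (hC : ∃ C : ℝ, ∀ z, |f z| ≤ C) :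
    ∫ q, ρ q * f (q.1, φ q) ∂(μy.prod ν) = ∫ z, R z * f z ∂(μy.prod μ₂) := by
  obtain ⟨C, hC⟩ := hC
  have hmf : Measurable fun q : Y × U => f (q.1, φ q) := hf.comp (measurable_fst.prodMk hφ)
  have hI1 : Integrable (fun q => ρ q * f (q.1, φ q)) (μy.prod ν) :=
    hρ.mul_bdd hmf.aestronglyMeasurable (Filter.Eventually.of_forall fun q => by simpa [Real.norm_eq_abs] using hC (q.1, φ q))
  have hI2 : Integrable (fun z => R z * f z) (μy.prod μ₂) :=
    hRint.mul_bdd hf.aestronglyMeasurable (Filter.Eventually.of_forall fun z => by simpa [Real.norm_eq_abs] using hC z)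
  rw [integral_prod _ hI1, integral_prod _ hI2]
  refine integral_congr_ae ?_
  filter_upwards [hfib] with y hy
  exact hy (fun v => f (y, v)) (hf.comp measurable_prodMk_left) ⟨C, fun v => hC (y, v)⟩

/-- ★★ **THE FUBINI REDUCTION, candidate nonnegative and measurable** (integrability of `R` derived by `integrable_candidate_of_fibrewise`). [folklore] -/
theorem weak_of_fibrewise_of_nonneg (μy : Measure Y) [SFinite μy] (ν : Measure U) [SFinite ν] (μ₂ : Measure V) [IsFiniteMeasure μ₂]
    {ρ : Y × U → ℝ} (hρ : Integrable ρ (μy.prod ν)) {φ : Y × U → V} (hφ : Measurable φ)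
    {R : Y × V → ℝ} (hR0 : ∀ z, 0 ≤ R z) (hRm : Measurable R)
    (hfib : ∀ᵐ y ∂μy, ∀ h : V → ℝ, Measurable h → (∃ C : ℝ, ∀ v, |h v| ≤ C) →
      ∫ u, ρ (y, u) * h (φ (y, u)) ∂ν = ∫ v, R (y, v) * h v ∂μ₂)
    (f : Y × V → ℝ) (hf : Measurable f) (hC : ∃ C : ℝ, ∀ z, |f z| ≤ C) :
    ∫ q, ρ q * f (q.1, φ q) ∂(μy.prod ν) = ∫ z, R z * f z ∂(μy.prod μ₂) :=
  weak_of_fibrewise μy ν μ₂ hρ hφ (integrable_candidate_of_fibrewise μy ν μ₂ hρ hφ hR0 hRm hfib) hfib f hf hC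

end Generic

/-! ## §2  Record letters: p646357's (hweak) VERBATIM from the frozen-`y` fibrewise identity; (hce₀) from it -/

section Record

variable {F : T4Family} {N : ℕ} [NeZero N]

/-- THE `dU`-FORM OF THE LEFT MEMBER: the glue `e⁻¹ : (U|_{sV}, U|_{sVᶜ}) ↦ U` is measure preserving (dag-n11-e's `measurePreserving_piEquivPiSubtypeProd_symm_fieldMeasure`), so
`∫ (ρ ∘ e⁻¹)(q) · F(q) dμ_in(q) = ∫ ρ(U) · F(e U) dU` for every `F` — the left member of (hweak) is an honest `dU`-integral. [cite: Balaban1988Convergent, (3.1) p.264; Balaban1987RG1, (0.4) p.253] -/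
theorem integral_comp_glue_symm_mul_eq (K k : ℕ) {hdec : DecidableEq (PBond (F.P K) k)} (sV : Finset (PBond (F.P K) k))
    (ρ : GaugeField (F.P K) k (SU N) → ℝ) (Fq : (↥sV → SU N) × ({b : PBond (F.P K) k // b ∉ sV} → SU N) → ℝ) :
    ∫ q, (ρ ∘ ⇑(MeasurableEquiv.piEquivPiSubtypeProd (fun _ : PBond (F.P K) k => SU N) (· ∈ sV)).symm) q * Fq q
        ∂((Measure.pi fun _ : ↥sV => (HaarData.haar : Measure (SU N))).prod
          (Measure.pi fun _ : {b : PBond (F.P K) k // b ∉ sV} => (HaarData.haar : Measure (SU N)))) =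
      ∫ U, ρ U * Fq (MeasurableEquiv.piEquivPiSubtypeProd (fun _ : PBond (F.P K) k => SU N) (· ∈ sV) U) ∂fieldMeasure (F.P K) k (SU N) := by
  have hpres := measurePreserving_piEquivPiSubtypeProd_symm_fieldMeasure (G := SU N) (P := F.P K) (j := k) sV
  have h1 : ∫ q, (ρ ∘ ⇑(MeasurableEquiv.piEquivPiSubtypeProd (fun _ : PBond (F.P K) k => SU N) (· ∈ sV)).symm) q * Fq q
        ∂((Measure.pi fun _ : ↥sV => (HaarData.haar : Measure (SU N))).prod
          (Measure.pi fun _ : {b : PBond (F.P K) k // b ∉ sV} => (HaarData.haar : Measure (SU N)))) =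
      ∫ q, (fun U => ρ U * Fq (MeasurableEquiv.piEquivPiSubtypeProd (fun _ : PBond (F.P K) k => SU N) (· ∈ sV) U))
          ((MeasurableEquiv.piEquivPiSubtypeProd (fun _ : PBond (F.P K) k => SU N) (· ∈ sV)).symm q)
        ∂((Measure.pi fun _ : ↥sV => (HaarData.haar : Measure (SU N))).prod
          (Measure.pi fun _ : {b : PBond (F.P K) k // b ∉ sV} => (HaarData.haar : Measure (SU N)))) :=
    integral_congr_ae (ae_of_all _ fun q => by simp only [Function.comp_apply, MeasurableEquiv.apply_symm_apply])
  rw [h1]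
  exact hpres.integral_comp' (fun U => ρ U * Fq (MeasurableEquiv.piEquivPiSubtypeProd (fun _ : PBond (F.P K) k => SU N) (· ∈ sV) U))

/-- ★★ **p646357's (hweak) FROM THE FROZEN-`y` FIBREWISE IDENTITY, candidate integrable** (record letters; ANY `dU`-integrable `ρ`, any finite bond sets `sV`, `sV'`): if for
`(⊗_{sV} dU)`-a.e. `y` and every bounded measurable `h` of the new variables `v : sV'ᶜ → SU(N)`,
`∫ ρ(e⁻¹(y,u)) · h(c ↦ Ū(e⁻¹(y,u))(c)) d(⊗_{sVᶜ} dU)(u) = ∫ R(y,v) · h(v) d(⊗_{sV'ᶜ} dV)(v)`, then the weak identity holds for every bounded measurable `f` of `(y, v)`.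
[cite: Balaban1988Convergent, (3.1) p.264, (3.10)–(3.14) p.267, (3.23)–(3.25) p.270; Balaban1987RG1, (0.4) p.253, §2 p.267] -/
theorem weak_of_fibrewise_at_record (K k : ℕ) {hdec : DecidableEq (PBond (F.P K) k)} {hdec' : DecidableEq (PBond (F.P K) (k + 1))} (sV : Finset (PBond (F.P K) k)) (sV' : Finset (PBond (F.P K) (k + 1)))
    {ρ : GaugeField (F.P K) k (SU N) → ℝ} (hρ : Integrable ρ (fieldMeasure (F.P K) k (SU N)))
    {R : (↥sV → SU N) × ({c : PBond (F.P K) (k + 1) // c ∉ sV'} → SU N) → ℝ}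
    (hRint : Integrable R ((Measure.pi fun _ : ↥sV => (HaarData.haar : Measure (SU N))).prod
      (Measure.pi fun _ : {c : PBond (F.P K) (k + 1) // c ∉ sV'} => (HaarData.haar : Measure (SU N)))))
    (hfib : ∀ᵐ y ∂(Measure.pi fun _ : ↥sV => (HaarData.haar : Measure (SU N))),
      ∀ h : ({c : PBond (F.P K) (k + 1) // c ∉ sV'} → SU N) → ℝ, Measurable h → (∃ C : ℝ, ∀ v, |h v| ≤ C) →
        ∫ u, ρ ((MeasurableEquiv.piEquivPiSubtypeProd (fun _ : PBond (F.P K) k => SU N) (· ∈ sV)).symm (y, u)) *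
            h (fun c : {c : PBond (F.P K) (k + 1) // c ∉ sV'} =>
              (avOfRecord F N K k).avg ((MeasurableEquiv.piEquivPiSubtypeProd (fun _ : PBond (F.P K) k => SU N) (· ∈ sV)).symm (y, u)) c)
          ∂(Measure.pi fun _ : {b : PBond (F.P K) k // b ∉ sV} => (HaarData.haar : Measure (SU N))) =
        ∫ v, R (y, v) * h v ∂(Measure.pi fun _ : {c : PBond (F.P K) (k + 1) // c ∉ sV'} => (HaarData.haar : Measure (SU N))))
    (f : (↥sV → SU N) × ({c : PBond (F.P K) (k + 1) // c ∉ sV'} → SU N) → ℝ) (hf : Measurable f) (hC : ∃ C : ℝ, ∀ z, |f z| ≤ C) :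
    ∫ q, (ρ ∘ ⇑(MeasurableEquiv.piEquivPiSubtypeProd (fun _ : PBond (F.P K) k => SU N) (· ∈ sV)).symm) q *
        f ((fun q => (q.1, fun c : {c : PBond (F.P K) (k + 1) // c ∉ sV'} =>
          (avOfRecord F N K k).avg ((MeasurableEquiv.piEquivPiSubtypeProd (fun _ : PBond (F.P K) k => SU N) (· ∈ sV)).symm q) c)) q)
        ∂((Measure.pi fun _ : ↥sV => (HaarData.haar : Measure (SU N))).prod
          (Measure.pi fun _ : {b : PBond (F.P K) k // b ∉ sV} => (HaarData.haar : Measure (SU N)))) =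
      ∫ z, R z * f z ∂((Measure.pi fun _ : ↥sV => (HaarData.haar : Measure (SU N))).prod
          (Measure.pi fun _ : {c : PBond (F.P K) (k + 1) // c ∉ sV'} => (HaarData.haar : Measure (SU N)))) := by
  have hpres := measurePreserving_piEquivPiSubtypeProd_symm_fieldMeasure (G := SU N) (P := F.P K) (j := k) sV
  have hρ' := (hpres.integrable_comp hρ.aestronglyMeasurable).mpr hρ
  exact weak_of_fibrewise _ _ _ hρ' (measurable_avOfRecord_glue_rest F N K k sV sV') hRint hfib f hf hC

/-- ★★ **p646357's (hweak) FROM THE FROZEN-`y` FIBREWISE IDENTITY, candidate nonnegative and measurable** (integrability of `R` derived, §1). [cite: Balaban1988Convergent, (3.1) p.264, (3.23)–(3.25) p.270; Balaban1987RG1, (0.4) p.253] -/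
theorem weak_of_fibrewise_of_nonneg_at_record (K k : ℕ) {hdec : DecidableEq (PBond (F.P K) k)} {hdec' : DecidableEq (PBond (F.P K) (k + 1))} (sV : Finset (PBond (F.P K) k)) (sV' : Finset (PBond (F.P K) (k + 1)))
    {ρ : GaugeField (F.P K) k (SU N) → ℝ} (hρ : Integrable ρ (fieldMeasure (F.P K) k (SU N)))
    {R : (↥sV → SU N) × ({c : PBond (F.P K) (k + 1) // c ∉ sV'} → SU N) → ℝ} (hR0 : ∀ z, 0 ≤ R z) (hRm : Measurable R)
    (hfib : ∀ᵐ y ∂(Measure.pi fun _ : ↥sV => (HaarData.haar : Measure (SU N))),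
      ∀ h : ({c : PBond (F.P K) (k + 1) // c ∉ sV'} → SU N) → ℝ, Measurable h → (∃ C : ℝ, ∀ v, |h v| ≤ C) →
        ∫ u, ρ ((MeasurableEquiv.piEquivPiSubtypeProd (fun _ : PBond (F.P K) k => SU N) (· ∈ sV)).symm (y, u)) *
            h (fun c : {c : PBond (F.P K) (k + 1) // c ∉ sV'} =>
              (avOfRecord F N K k).avg ((MeasurableEquiv.piEquivPiSubtypeProd (fun _ : PBond (F.P K) k => SU N) (· ∈ sV)).symm (y, u)) c)
          ∂(Measure.pi fun _ : {b : PBond (F.P K) k // b ∉ sV} => (HaarData.haar : Measure (SU N))) =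
        ∫ v, R (y, v) * h v ∂(Measure.pi fun _ : {c : PBond (F.P K) (k + 1) // c ∉ sV'} => (HaarData.haar : Measure (SU N))))
    (f : (↥sV → SU N) × ({c : PBond (F.P K) (k + 1) // c ∉ sV'} → SU N) → ℝ) (hf : Measurable f) (hC : ∃ C : ℝ, ∀ z, |f z| ≤ C) :
    ∫ q, (ρ ∘ ⇑(MeasurableEquiv.piEquivPiSubtypeProd (fun _ : PBond (F.P K) k => SU N) (· ∈ sV)).symm) q *
        f ((fun q => (q.1, fun c : {c : PBond (F.P K) (k + 1) // c ∉ sV'} =>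
          (avOfRecord F N K k).avg ((MeasurableEquiv.piEquivPiSubtypeProd (fun _ : PBond (F.P K) k => SU N) (· ∈ sV)).symm q) c)) q)
        ∂((Measure.pi fun _ : ↥sV => (HaarData.haar : Measure (SU N))).prod
          (Measure.pi fun _ : {b : PBond (F.P K) k // b ∉ sV} => (HaarData.haar : Measure (SU N)))) =
      ∫ z, R z * f z ∂((Measure.pi fun _ : ↥sV => (HaarData.haar : Measure (SU N))).prod
          (Measure.pi fun _ : {c : PBond (F.P K) (k + 1) // c ∉ sV'} => (HaarData.haar : Measure (SU N)))) := by
  have hpres := measurePreserving_piEquivPiSubtypeProd_symm_fieldMeasure (G := SU N) (P := F.P K) (j := k) sV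
  have hρ' := (hpres.integrable_comp hρ.aestronglyMeasurable).mpr hρ
  exact weak_of_fibrewise_of_nonneg _ _ _ hρ' (measurable_avOfRecord_glue_rest F N K k sV sV') hR0 hRm hfib f hf hC

/-- ★★★ **(hce₀) FROM THE FROZEN-`y` FIBREWISE IDENTITY** at 11a's generation letters `sV = B_k(Ω^c_{k+1}(s′))`, `sV' = B_{k+1}(Ω^c_{k+1}(s′))`, candidate nonnegative and measurable:
def-T's skew conditional expectation `kernelTransport μ_in μ_out skew (ρ ∘ e⁻¹)` IS `R`, `μ_out`-a.e. (p646357 `condExp_identity_of_weak_of_nonneg` ∘ §2).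
[cite: Balaban1988Convergent, (2.21) p.258, (3.1) p.264, (3.23)–(3.25) p.270; Balaban1987RG1, (0.4) p.253, §2 p.267] -/
theorem condExp_identity_of_fibrewise_of_nonneg (ν : Stage7Numerics) (M : ℕ) (g : ℕ → ℝ) (p : B12.RunParams)
    {k : ℕ} {hdec : DecidableEq (PBond (F.P p.K) k)} {hdec' : DecidableEq (PBond (F.P p.K) (k + 1))} (hk : k + 1 ≤ (F.P p.K).m + (F.P p.K).K)
    (s' : SeqOfRecord F ν M g p.K (k + 1)) {ρ : GaugeField (F.P p.K) k (SU N) → ℝ} (hρ : Integrable ρ (fieldMeasure (F.P p.K) k (SU N)))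
    {R : ((↥(Set.toFinite (bondsIn k (s'.Ω (k + 1))ᶜ)).toFinset → SU N) × ({c : PBond (F.P p.K) (k + 1) // c ∉ (Set.toFinite (bondsIn (k + 1) (s'.Ω (k + 1))ᶜ)).toFinset} → SU N)) → ℝ}
    (hR0 : ∀ z, 0 ≤ R z) (hRm : Measurable R)
    (hfib : ∀ᵐ y ∂(Measure.pi fun _ : ↥(Set.toFinite (bondsIn k (s'.Ω (k + 1))ᶜ)).toFinset => (HaarData.haar : Measure (SU N))),
      ∀ h : ({c : PBond (F.P p.K) (k + 1) // c ∉ (Set.toFinite (bondsIn (k + 1) (s'.Ω (k + 1))ᶜ)).toFinset} → SU N) → ℝ, Measurable h → (∃ C : ℝ, ∀ v, |h v| ≤ C) →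
        ∫ u, ρ ((MeasurableEquiv.piEquivPiSubtypeProd (fun _ : PBond (F.P p.K) k => SU N)
              (· ∈ (Set.toFinite (bondsIn k (s'.Ω (k + 1))ᶜ)).toFinset)).symm (y, u)) *
            h (fun c : {c : PBond (F.P p.K) (k + 1) // c ∉ (Set.toFinite (bondsIn (k + 1) (s'.Ω (k + 1))ᶜ)).toFinset} =>
              (avOfRecord F N p.K k).avg ((MeasurableEquiv.piEquivPiSubtypeProd (fun _ : PBond (F.P p.K) k => SU N)
                (· ∈ (Set.toFinite (bondsIn k (s'.Ω (k + 1))ᶜ)).toFinset)).symm (y, u)) c)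
          ∂(Measure.pi fun _ : {b : PBond (F.P p.K) k // b ∉ (Set.toFinite (bondsIn k (s'.Ω (k + 1))ᶜ)).toFinset} => (HaarData.haar : Measure (SU N))) =
        ∫ v, R (y, v) * h v ∂(Measure.pi fun _ : {c : PBond (F.P p.K) (k + 1) // c ∉ (Set.toFinite (bondsIn (k + 1) (s'.Ω (k + 1))ᶜ)).toFinset} =>
          (HaarData.haar : Measure (SU N)))) :
    kernelTransport
        ((Measure.pi fun _ : ↥(Set.toFinite (bondsIn k (s'.Ω (k + 1))ᶜ)).toFinset => (HaarData.haar : Measure (SU N))).prod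
          (Measure.pi fun _ : {b : PBond (F.P p.K) k // b ∉ (Set.toFinite (bondsIn k (s'.Ω (k + 1))ᶜ)).toFinset} => (HaarData.haar : Measure (SU N))))
        ((Measure.pi fun _ : ↥(Set.toFinite (bondsIn k (s'.Ω (k + 1))ᶜ)).toFinset => (HaarData.haar : Measure (SU N))).prod
          (Measure.pi fun _ : {c : PBond (F.P p.K) (k + 1) // c ∉ (Set.toFinite (bondsIn (k + 1) (s'.Ω (k + 1))ᶜ)).toFinset} =>
            (HaarData.haar : Measure (SU N))))
        (fun q => (q.1, fun c : {c : PBond (F.P p.K) (k + 1) // c ∉ (Set.toFinite (bondsIn (k + 1) (s'.Ω (k + 1))ᶜ)).toFinset} =>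
          (avOfRecord F N p.K k).avg
            ((MeasurableEquiv.piEquivPiSubtypeProd (fun _ : PBond (F.P p.K) k => SU N)
              (· ∈ (Set.toFinite (bondsIn k (s'.Ω (k + 1))ᶜ)).toFinset)).symm q) c))
        (ρ ∘ ⇑(MeasurableEquiv.piEquivPiSubtypeProd (fun _ : PBond (F.P p.K) k => SU N)
            (· ∈ (Set.toFinite (bondsIn k (s'.Ω (k + 1))ᶜ)).toFinset)).symm)
      =ᵐ[((Measure.pi fun _ : ↥(Set.toFinite (bondsIn k (s'.Ω (k + 1))ᶜ)).toFinset => (HaarData.haar : Measure (SU N))).prod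
          (Measure.pi fun _ : {c : PBond (F.P p.K) (k + 1) // c ∉ (Set.toFinite (bondsIn (k + 1) (s'.Ω (k + 1))ᶜ)).toFinset} =>
            (HaarData.haar : Measure (SU N))))] R :=
by
  have hw := weak_of_fibrewise_of_nonneg_at_record (F := F) (N := N) p.K k (hdec := hdec) (hdec' := hdec') (Set.toFinite (bondsIn k (s'.Ω (k + 1))ᶜ)).toFinset
    (Set.toFinite (bondsIn (k + 1) (s'.Ω (k + 1))ᶜ)).toFinset hρ hR0 hRm hfib
  exact condExp_identity_of_weak_of_nonneg ν M g p (hdec := hdec) (hdec' := hdec') hk s' hρ hR0 hRm hw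

/-- ★★★ **(hce₀) FROM THE FROZEN-`y` FIBREWISE IDENTITY, candidate integrable** (p646357 `condExp_identity_of_weak` ∘ §2). [cite: Balaban1988Convergent, (2.21) p.258, (3.1) p.264, (3.23)–(3.25) p.270; Balaban1987RG1, (0.4) p.253] -/
theorem condExp_identity_of_fibrewise (ν : Stage7Numerics) (M : ℕ) (g : ℕ → ℝ) (p : B12.RunParams)
    {k : ℕ} {hdec : DecidableEq (PBond (F.P p.K) k)} {hdec' : DecidableEq (PBond (F.P p.K) (k + 1))} (hk : k + 1 ≤ (F.P p.K).m + (F.P p.K).K)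
    (s' : SeqOfRecord F ν M g p.K (k + 1)) {ρ : GaugeField (F.P p.K) k (SU N) → ℝ} (hρ : Integrable ρ (fieldMeasure (F.P p.K) k (SU N)))
    {R : ((↥(Set.toFinite (bondsIn k (s'.Ω (k + 1))ᶜ)).toFinset → SU N) × ({c : PBond (F.P p.K) (k + 1) // c ∉ (Set.toFinite (bondsIn (k + 1) (s'.Ω (k + 1))ᶜ)).toFinset} → SU N)) → ℝ}
    (hRint : Integrable R ((Measure.pi fun _ : ↥(Set.toFinite (bondsIn k (s'.Ω (k + 1))ᶜ)).toFinset => (HaarData.haar : Measure (SU N))).prod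
          (Measure.pi fun _ : {c : PBond (F.P p.K) (k + 1) // c ∉ (Set.toFinite (bondsIn (k + 1) (s'.Ω (k + 1))ᶜ)).toFinset} =>
            (HaarData.haar : Measure (SU N)))))
    (hfib : ∀ᵐ y ∂(Measure.pi fun _ : ↥(Set.toFinite (bondsIn k (s'.Ω (k + 1))ᶜ)).toFinset => (HaarData.haar : Measure (SU N))),
      ∀ h : ({c : PBond (F.P p.K) (k + 1) // c ∉ (Set.toFinite (bondsIn (k + 1) (s'.Ω (k + 1))ᶜ)).toFinset} → SU N) → ℝ, Measurable h → (∃ C : ℝ, ∀ v, |h v| ≤ C) →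
        ∫ u, ρ ((MeasurableEquiv.piEquivPiSubtypeProd (fun _ : PBond (F.P p.K) k => SU N)
              (· ∈ (Set.toFinite (bondsIn k (s'.Ω (k + 1))ᶜ)).toFinset)).symm (y, u)) *
            h (fun c : {c : PBond (F.P p.K) (k + 1) // c ∉ (Set.toFinite (bondsIn (k + 1) (s'.Ω (k + 1))ᶜ)).toFinset} =>
              (avOfRecord F N p.K k).avg ((MeasurableEquiv.piEquivPiSubtypeProd (fun _ : PBond (F.P p.K) k => SU N)
                (· ∈ (Set.toFinite (bondsIn k (s'.Ω (k + 1))ᶜ)).toFinset)).symm (y, u)) c)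
          ∂(Measure.pi fun _ : {b : PBond (F.P p.K) k // b ∉ (Set.toFinite (bondsIn k (s'.Ω (k + 1))ᶜ)).toFinset} => (HaarData.haar : Measure (SU N))) =
        ∫ v, R (y, v) * h v ∂(Measure.pi fun _ : {c : PBond (F.P p.K) (k + 1) // c ∉ (Set.toFinite (bondsIn (k + 1) (s'.Ω (k + 1))ᶜ)).toFinset} =>
          (HaarData.haar : Measure (SU N)))) :
    kernelTransport
        ((Measure.pi fun _ : ↥(Set.toFinite (bondsIn k (s'.Ω (k + 1))ᶜ)).toFinset => (HaarData.haar : Measure (SU N))).prod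
          (Measure.pi fun _ : {b : PBond (F.P p.K) k // b ∉ (Set.toFinite (bondsIn k (s'.Ω (k + 1))ᶜ)).toFinset} => (HaarData.haar : Measure (SU N))))
        ((Measure.pi fun _ : ↥(Set.toFinite (bondsIn k (s'.Ω (k + 1))ᶜ)).toFinset => (HaarData.haar : Measure (SU N))).prod
          (Measure.pi fun _ : {c : PBond (F.P p.K) (k + 1) // c ∉ (Set.toFinite (bondsIn (k + 1) (s'.Ω (k + 1))ᶜ)).toFinset} =>
            (HaarData.haar : Measure (SU N))))
        (fun q => (q.1, fun c : {c : PBond (F.P p.K) (k + 1) // c ∉ (Set.toFinite (bondsIn (k + 1) (s'.Ω (k + 1))ᶜ)).toFinset} =>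
          (avOfRecord F N p.K k).avg
            ((MeasurableEquiv.piEquivPiSubtypeProd (fun _ : PBond (F.P p.K) k => SU N)
              (· ∈ (Set.toFinite (bondsIn k (s'.Ω (k + 1))ᶜ)).toFinset)).symm q) c))
        (ρ ∘ ⇑(MeasurableEquiv.piEquivPiSubtypeProd (fun _ : PBond (F.P p.K) k => SU N)
            (· ∈ (Set.toFinite (bondsIn k (s'.Ω (k + 1))ᶜ)).toFinset)).symm)
      =ᵐ[((Measure.pi fun _ : ↥(Set.toFinite (bondsIn k (s'.Ω (k + 1))ᶜ)).toFinset => (HaarData.haar : Measure (SU N))).prod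
          (Measure.pi fun _ : {c : PBond (F.P p.K) (k + 1) // c ∉ (Set.toFinite (bondsIn (k + 1) (s'.Ω (k + 1))ᶜ)).toFinset} =>
            (HaarData.haar : Measure (SU N))))] R :=
by
  have hw := weak_of_fibrewise_at_record (F := F) (N := N) p.K k (hdec := hdec) (hdec' := hdec') (Set.toFinite (bondsIn k (s'.Ω (k + 1))ᶜ)).toFinset
    (Set.toFinite (bondsIn (k + 1) (s'.Ω (k + 1))ᶜ)).toFinset hρ hRint hfib
  exact condExp_identity_of_weak ν M g p (hdec := hdec) (hdec' := hdec') hk s' hρ hRint hw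

end Record

end Summit.QuantumFields.YangMills.Theorems.BalabanUVNodesN11CondExpOfFibrewiseIdentity

end
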